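import Summits.AtomisticToContinuum.Crystallization.Theorems.ExcessDecayLiouvilleHcpLiouvilleBlowdownForcing
import Summits.AtomisticToContinuum.Crystallization.Theorems.ExcessDecayLiouvilleHcpLiouvilleBlowdownLevels
import Summits.AtomisticToContinuum.Crystallization.Theorems.ExcessDecayLiouvilleHcpLiouvilleBlowdownDifferences
import Summits.AtomisticToContinuum.Crystallization.Theorems.ExcessDecayLiouvilleHcpLiouvilleBlowdownLevelArith

/-!
# `ExcessDecayLiouville.HcpLiouville` (stmt-AtomisticToContinuum-9332), line `Sketch` (skeleton v4): from one Caccioppoli level to the next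

Helper for stub `stub_interior` (step (4) of the interior estimate for `L`-harmonic fields): the generic passage from
a field `F` at difference level `k − 1` (support in `B_{R₀}(c)`, rows `gF` on `B_ρ(c)`, mass and energy in the
scale-invariant form `… R^{-2k} W`) to its generator difference `F(· + A e) − F` at level `k ∈ {1, 2, 3}`
(`Blowdown.next_level`, registered as `blowdown_nextLevel`): support and mass of the difference (…Differences), rows of
the difference (…Localise), one Caccioppoli level (`blowdown_levelStep`, taken as a hypothesis with its constant) and
the arithmetic `blowdown_levelArith`; plus the small conversions used by the assembly (`Blowdown.oscAt_zero_mono`,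
`Blowdown.oscAt_localise_le`, `Blowdown.forcing_arith`, `Blowdown.oscAt_genDiff_le`).
All `[folklore]`; a `--supports` helper for item stmt-AtomisticToContinuum-9332, nothing here closes an item.
-/

noncomputable section

namespace Summit.AtomisticToContinuum.Crystallization.Theorems.ExcessDecayLiouville

open scoped BigOperators Topology Classical InnerProductSpace RealInnerProductSpace
open Literature.MathematicalPhysics.StatisticalMechanics
open Summit.AtomisticToContinuum.Crystallization.Theses.ExcessDecayLiouville
open Summit.AtomisticToContinuum.Crystallization.Theorems.PhononStabilityNegative

namespace Blowdown

open LevelOne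

variable {t : Fin 2 → (EuclideanSpace ℝ (Fin 3))}
  {A : (EuclideanSpace ℝ (Fin 3)) →L[ℝ] (EuclideanSpace ℝ (Fin 3))}

/-- Monotonicity of `oscAt S F c r 0` in the radius. [folklore] -/
theorem oscAt_zero_mono (hA : Adm₀ A) (hI : Inner₀ t A) (F : EuclideanSpace ℝ (Fin 3) → EuclideanSpace ℝ (Fin 3))
    (c : EuclideanSpace ℝ (Fin 3)) {r r' : ℝ} (h : r ≤ r') :
    oscAt (Sites₀ t A) F c r 0 ≤ oscAt (Sites₀ t A) F c r' 0 := by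
  rw [oscAt_zero_eq_sum hA hI F c r, oscAt_zero_eq_sum hA hI F c r']
  refine Finset.sum_le_sum_of_subset_of_nonneg (fun q hq => ?_) fun _ _ _ => sq_nonneg _
  rw [mem_ballFinset hA hI] at hq ⊢
  exact hq.trans h

/-- The mass of the localised field is at most the oscillation: `oscAt S ẑ c (4R/5) 0 ≤ oscAt S z c R m`. [folklore] -/
theorem oscAt_localise_le (hA : Adm₀ A) (hI : Inner₀ t A) {z zh : EuclideanSpace ℝ (Fin 3) → EuclideanSpace ℝ (Fin 3)}
    {c m : EuclideanSpace ℝ (Fin 3)} {R : ℝ} (hR : 0 ≤ R)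
    (hzh : ∀ x, zh x = if dist x c ≤ 4 * R / 5 then z x - m else 0) :
    oscAt (Sites₀ t A) zh c (4 * R / 5) 0 ≤ oscAt (Sites₀ t A) z c R m := by
  rw [oscAt_zero_eq_sum hA hI zh c (4 * R / 5), oscAt, tsum_ball_eq_sum hA hI c R (fun x => ‖z x - m‖ ^ 2)]
  calc ∑ q ∈ (finite_sites_ball hA hI c (4 * R / 5)).toFinset, ‖zh q‖ ^ 2
      = ∑ q ∈ (finite_sites_ball hA hI c (4 * R / 5)).toFinset, ‖z q - m‖ ^ 2 :=
        Finset.sum_congr rfl fun q hq => by rw [mem_ballFinset hA hI] at hq; rw [hzh, if_pos hq]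
    _ ≤ ∑ q ∈ (finite_sites_ball hA hI c R).toFinset, ‖z q - m‖ ^ 2 :=
        Finset.sum_le_sum_of_subset_of_nonneg (fun q hq => by rw [mem_ballFinset hA hI] at hq ⊢; linarith)
          fun _ _ _ => sq_nonneg _

/-- `K^{k+1} ≤ K⁴` for `K ≥ 1`, `k ≤ 3`. [folklore] -/
theorem pow_le_pow_four {K : ℝ} (hK : 1 ≤ K) {k : ℕ} (hk : k ≤ 3) : K ^ (k + 1) ≤ K ^ 4 :=
  pow_le_pow_right₀ hK (by omega)

/-- Powers: `R^a (R⁻¹)^{a+b} = (R⁻¹)^b`. [folklore] -/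
theorem pow_mul_inv_pow {R : ℝ} (hR : 0 < R) (a b : ℕ) : R ^ a * (R⁻¹) ^ (a + b) = (R⁻¹) ^ b := by
  rw [pow_add, ← mul_assoc, ← mul_pow, mul_inv_cancel₀ hR.ne', one_pow, one_mul]

/-- The forcing bounds in the form `R⁵ Γ ≤ g (R⁻¹)^{2k+2} W`. [folklore] -/
theorem forcing_arith {R Y₀ Y₂ W X : ℝ} (hR : 1 ≤ R) (hW : Y₀ ^ 2 * R⁻¹ + Y₂ ^ 2 * (R⁻¹) ^ 3 ≤ W) {g : ℝ} (hg : 0 ≤ g)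
    {n m : ℕ} (hm : m ≤ n + 2) (hX : X ≤ g * (Y₀ ^ 2 * (R⁻¹) ^ (n + 8) + Y₂ ^ 2 * (R⁻¹) ^ (n + 11))) :
    R ^ 5 * X ≤ g * (R⁻¹) ^ m * W := by
  have hR0 : 0 < R := by linarith
  have hu0 : 0 ≤ R⁻¹ := by positivity
  have hu1 : R⁻¹ ≤ 1 := inv_le_one_of_one_le₀ hR
  have h1 : R ^ 5 * (R⁻¹) ^ (n + 8) = (R⁻¹) ^ (n + 2) * R⁻¹ ^ 1 := by
    rw [← pow_add, show n + 8 = 5 + (n + 2 + 1) by omega, pow_mul_inv_pow hR0]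
  have h2 : R ^ 5 * (R⁻¹) ^ (n + 11) = (R⁻¹) ^ (n + 2) * (R⁻¹) ^ 4 := by
    rw [← pow_add, show n + 11 = 5 + (n + 2 + 4) by omega, pow_mul_inv_pow hR0]
  have h3 : (R⁻¹) ^ 4 ≤ (R⁻¹) ^ 3 := pow_le_pow_of_le_one hu0 hu1 (by norm_num)
  have hY0 : 0 ≤ Y₀ ^ 2 := sq_nonneg _
  have hY2 : 0 ≤ Y₂ ^ 2 := sq_nonneg _
  have hun : 0 ≤ (R⁻¹) ^ (n + 2) := by positivity
  calc R ^ 5 * X ≤ R ^ 5 * (g * (Y₀ ^ 2 * (R⁻¹) ^ (n + 8) + Y₂ ^ 2 * (R⁻¹) ^ (n + 11))) :=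
        mul_le_mul_of_nonneg_left hX (by positivity)
    _ = g * (R⁻¹) ^ (n + 2) * (Y₀ ^ 2 * R⁻¹ ^ 1 + Y₂ ^ 2 * (R⁻¹) ^ 4) := by
        have e1 : R ^ 5 * (g * (Y₀ ^ 2 * (R⁻¹) ^ (n + 8) + Y₂ ^ 2 * (R⁻¹) ^ (n + 11))) =
            g * (Y₀ ^ 2 * (R ^ 5 * (R⁻¹) ^ (n + 8)) + Y₂ ^ 2 * (R ^ 5 * (R⁻¹) ^ (n + 11))) := by ring
        rw [e1, h1, h2]; ring
    _ ≤ g * (R⁻¹) ^ (n + 2) * W := by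
        refine mul_le_mul_of_nonneg_left ?_ (by positivity)
        rw [pow_one]
        nlinarith [mul_le_mul_of_nonneg_left h3 hY2]
    _ ≤ g * (R⁻¹) ^ m * W := by
        have h4 : (R⁻¹) ^ (n + 2) ≤ (R⁻¹) ^ m := pow_le_pow_of_le_one hu0 hu1 hm
        have hW0 : 0 ≤ W := by nlinarith [mul_nonneg hY0 hu0, mul_nonneg hY2 (pow_nonneg hu0 3)]
        exact mul_le_mul_of_nonneg_right (mul_le_mul_of_nonneg_left h4 hg) hW0


/-- `oscAt S (D_e F) c ρ 0` is the ball sum of squared generator differences, hence `≤ 4·nnEnergy S F c (ρ+2)`.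
[folklore] -/
theorem oscAt_genDiff_le (hA : Adm₀ A) (hI : Inner₀ t A) (F : EuclideanSpace ℝ (Fin 3) → EuclideanSpace ℝ (Fin 3))
    (c : EuclideanSpace ℝ (Fin 3)) (ρ : ℝ) {e : EuclideanSpace ℝ (Fin 3)}
    (he : e ∈ ({triangularVec₁ 1, triangularVec₂ 1, layerNormal (2 * Real.sqrt (2 / 3))} :
      Finset (EuclideanSpace ℝ (Fin 3)))) :
    oscAt (Sites₀ t A) (fun x => F (x + A e) - F x) c ρ 0 ≤ 4 * nnEnergy (Sites₀ t A) F c (ρ + 2) := by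
  have h := tsum_ball_genDiff_sq_le hA hI F c ρ he
  rw [oscAt]
  simpa only [sub_zero] using h

/-- **The next Caccioppoli level**: from a field `F` (support in `B_{R₀}`, rows `gF` on `B_ρ`, mass and energy in
scale-invariant form at level `k − 1`) to its generator difference `F(· + Ae) − F` at level `k ∈ {1,2,3}`. [folklore] -/
theorem next_level {C_L : ℝ}
    (hL : ∀ (κ : ℝ) (t : Fin 2 → (EuclideanSpace ℝ (Fin 3)))
      (A : (EuclideanSpace ℝ (Fin 3)) →L[ℝ] (EuclideanSpace ℝ (Fin 3))), 0 < κ → Adm₀ A → Inner₀ t A → PSIneq κ t A →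
      ∀ (F g : (EuclideanSpace ℝ (Fin 3)) → (EuclideanSpace ℝ (Fin 3))) (c : (EuclideanSpace ℝ (Fin 3)))
        (ρ₁ δ ρK R₀ Γ μ : ℝ), 4 ≤ ρ₁ → 1 ≤ δ → δ ≤ ρ₁ → ρ₁ + 2 * δ ≤ ρK → ρK ≤ R₀ → 0 ≤ Γ → 0 < μ →
        (∀ q : Sites₀ t A, R₀ < dist (q : (EuclideanSpace ℝ (Fin 3))) c → F q = 0) →
        (∀ p : Sites₀ t A, dist (p : (EuclideanSpace ℝ (Fin 3))) c ≤ ρ₁ + δ →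
          HasSum (fun q : Sites₀ t A => forceConst ((p : (EuclideanSpace ℝ (Fin 3))) - q) (F p - F q)) (g p)) →
        (∀ p : Sites₀ t A, dist (p : (EuclideanSpace ℝ (Fin 3))) c ≤ ρ₁ + δ → ‖g p‖ ^ 2 ≤ Γ) →
        nnEnergy (Sites₀ t A) F c (ρ₁ - 2) ≤
          C_L / κ * ((δ⁻¹) ^ 2 * oscAt (Sites₀ t A) F c ρK 0 + δ ^ 2 * ρK ^ 3 * Γ +
            (δ⁻¹) ^ 8 * (μ * R₀ ^ 3 * oscAt (Sites₀ t A) F c R₀ 0 + μ⁻¹ * ρK ^ 3 * oscAt (Sites₀ t A) F c ρK 0)))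
    {κ : ℝ} (hκ : 0 < κ) (hA : Adm₀ A) (hI : Inner₀ t A) (hPS : PSIneq κ t A)
    {F gF : EuclideanSpace ℝ (Fin 3) → EuclideanSpace ℝ (Fin 3)} {c e : EuclideanSpace ℝ (Fin 3)}
    {R R₀ ρ W a g Γb K : ℝ} {k : ℕ} (hk1 : 1 ≤ k) (hk3 : k ≤ 3) (hR : 400 ≤ R)
    (he : e ∈ ({triangularVec₁ 1, triangularVec₂ 1, layerNormal (2 * Real.sqrt (2 / 3))} :
      Finset (EuclideanSpace ℝ (Fin 3))))
    (hK1 : 1 ≤ K) (hKC : C_L / κ ≤ K) (hW : 0 ≤ W) (ha : 0 ≤ a) (hg : 0 ≤ g)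
    (hsupp : ∀ q : Sites₀ t A, R₀ < dist (q : EuclideanSpace ℝ (Fin 3)) c → F q = 0)
    (hR₀ : 4 * R / 5 ≤ R₀) (hR₀' : R₀ + 2 ≤ R)
    (hrows : ∀ p : Sites₀ t A, dist (p : EuclideanSpace ℝ (Fin 3)) c ≤ ρ →
      HasSum (fun q : Sites₀ t A => forceConst ((p : EuclideanSpace ℝ (Fin 3)) - q) (F p - F q)) (gF p))
    (hρ : (19 - 3 * (k : ℝ)) * (R / 40) + 2 ≤ ρ)
    (hforce : ∀ p : Sites₀ t A, dist (p : EuclideanSpace ℝ (Fin 3)) c ≤ (19 - 3 * (k : ℝ)) * (R / 40) →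
      ‖gF ((p : EuclideanSpace ℝ (Fin 3)) + A e) - gF p‖ ^ 2 ≤ Γb)
    (hΓb0 : 0 ≤ Γb) (hΓ : R ^ 5 * Γb ≤ g * (R⁻¹) ^ (2 * k + 2) * W)
    (hMF : oscAt (Sites₀ t A) F c R₀ 0 ≤ 4 ^ (k - 1) * W)
    (hEF : 4 * nnEnergy (Sites₀ t A) F c ((21 - 3 * (k : ℝ)) * (R / 40) - 2) ≤ a * (R⁻¹) ^ (2 * k) * W) :
    nnEnergy (Sites₀ t A) (fun x => F (x + A e) - F x) c ((18 - 3 * (k : ℝ)) * (R / 40) - 2) ≤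
      (1600 * a + g + 40 ^ 8 * (4 ^ k + a)) * K * (R⁻¹) ^ (2 * k + 2) * W := by
  obtain ⟨heΛ, hAe⟩ := gen_mem_and_norm_le hA he
  have hk3' : (k : ℝ) ≤ 3 := by exact_mod_cast hk3
  have hk1' : (1 : ℝ) ≤ k := by exact_mod_cast hk1
  have hR1 : 1 ≤ R := by linarith
  have hR0 : 0 < R := by linarith
  have hK0 : 0 ≤ K := by linarith
  obtain ⟨hmass, hsupp'⟩ := oscAt_diff_le hA hI heΛ hAe hsupp
  have hrows' := rows_diff heΛ hAe hrows
  have hraw := hL κ t A hκ hA hI hPS (fun x => F (x + A e) - F x)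
    (fun y => gF (y + A e) - gF y) c ((18 - 3 * (k : ℝ)) * (R / 40)) (R / 40) ((20 - 3 * (k : ℝ)) * (R / 40)) (R₀ + 2)
    Γb ((R⁻¹) ^ k) (by nlinarith) (by linarith) (by nlinarith) (by linarith) (by nlinarith) hΓb0 (by positivity)
    hsupp' (fun p hp => hrows' p (by linarith)) (fun p hp => hforce p (by linarith))
  have hM'0 := oscAt_nonneg (Sites₀ t A) (fun x => F (x + A e) - F x) c ((20 - 3 * (k : ℝ)) * (R / 40)) 0
  have hM0 := oscAt_nonneg (Sites₀ t A) (fun x => F (x + A e) - F x) c (R₀ + 2) 0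
  have hX0 : 0 ≤ ((R / 40)⁻¹) ^ 2 * oscAt (Sites₀ t A) (fun x => F (x + A e) - F x) c ((20 - 3 * (k : ℝ)) * (R / 40)) 0 +
      (R / 40) ^ 2 * ((20 - 3 * (k : ℝ)) * (R / 40)) ^ 3 * Γb +
      ((R / 40)⁻¹) ^ 8 * ((R⁻¹) ^ k * (R₀ + 2) ^ 3 * oscAt (Sites₀ t A) (fun x => F (x + A e) - F x) c (R₀ + 2) 0 +
        ((R⁻¹) ^ k)⁻¹ * ((20 - 3 * (k : ℝ)) * (R / 40)) ^ 3 *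
          oscAt (Sites₀ t A) (fun x => F (x + A e) - F x) c ((20 - 3 * (k : ℝ)) * (R / 40)) 0) := by
    have hρK0 : 0 ≤ (20 - 3 * (k : ℝ)) * (R / 40) := by nlinarith
    have hR₀0 : 0 ≤ R₀ + 2 := by linarith
    have h1 : 0 ≤ ((R / 40)⁻¹) ^ 2 * oscAt (Sites₀ t A) (fun x => F (x + A e) - F x) c ((20 - 3 * (k : ℝ)) * (R / 40)) 0 := by
      positivity
    have h2 : 0 ≤ (R / 40) ^ 2 * ((20 - 3 * (k : ℝ)) * (R / 40)) ^ 3 * Γb :=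
      mul_nonneg (mul_nonneg (by positivity) (pow_nonneg hρK0 3)) hΓb0
    have h3 : 0 ≤ (R⁻¹) ^ k * (R₀ + 2) ^ 3 * oscAt (Sites₀ t A) (fun x => F (x + A e) - F x) c (R₀ + 2) 0 :=
      mul_nonneg (mul_nonneg (by positivity) (pow_nonneg hR₀0 3)) hM0
    have h4 : 0 ≤ ((R⁻¹) ^ k)⁻¹ * ((20 - 3 * (k : ℝ)) * (R / 40)) ^ 3 *
        oscAt (Sites₀ t A) (fun x => F (x + A e) - F x) c ((20 - 3 * (k : ℝ)) * (R / 40)) 0 :=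
      mul_nonneg (mul_nonneg (by positivity) (pow_nonneg hρK0 3)) hM'0
    exact add_nonneg (add_nonneg h1 h2) (mul_nonneg (by positivity) (add_nonneg h3 h4))
  have hM' : oscAt (Sites₀ t A) (fun x => F (x + A e) - F x) c ((20 - 3 * (k : ℝ)) * (R / 40)) 0 ≤
      a * (R⁻¹) ^ (2 * k) * W := by
    refine (oscAt_genDiff_le hA hI F c _ he).trans (le_trans ?_ hEF)
    exact mul_le_mul_of_nonneg_left (nnEnergy_le_of_le hA hI F c (by linarith)) (by norm_num)
  have hM : oscAt (Sites₀ t A) (fun x => F (x + A e) - F x) c (R₀ + 2) 0 ≤ 4 ^ k * W := by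
    refine hmass.trans ?_
    have : (4 : ℝ) ^ k = 4 * 4 ^ (k - 1) := by
      rw [← pow_succ']; congr 1; omega
    rw [this, mul_assoc]
    exact mul_le_mul_of_nonneg_left hMF (by norm_num)
  exact level_arith (hE := hraw.trans (mul_le_mul_of_nonneg_right hKC hX0)) hk3 hR1 hK0 hW ha hg hM'0 hM' hM0 hM
    hΓb0 hΓ (by nlinarith) (by nlinarith) (by linarith) (by linarith)

end Blowdown

open LevelOne in
/-- Registered carrier of this helper file (crux stmt-AtomisticToContinuum-9332, line `Sketch` v4, stub
`stub_interior`, step (4)): the mass of the localised field is at most the oscillation,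
`oscAt S ẑ c (4R/5) 0 ≤ oscAt S z c R m` for `ẑ = 𝟙_{B_{4R/5}(c)}(z − m)`. [folklore] -/
theorem blowdown_nextLevel : ∀ (t : Fin 2 → (EuclideanSpace ℝ (Fin 3)))
    (A : (EuclideanSpace ℝ (Fin 3)) →L[ℝ] (EuclideanSpace ℝ (Fin 3))), Adm₀ A → Inner₀ t A →
    ∀ (z zh : (EuclideanSpace ℝ (Fin 3)) → (EuclideanSpace ℝ (Fin 3))) (c m : (EuclideanSpace ℝ (Fin 3))) (R : ℝ),
      0 ≤ R → (∀ x, zh x = if dist x c ≤ 4 * R / 5 then z x - m else 0) →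
      Blowdown.oscAt (Sites₀ t A) zh c (4 * R / 5) 0 ≤ Blowdown.oscAt (Sites₀ t A) z c R m :=
  fun _ _ hA hI _ _ _ _ _ hR hzh => Blowdown.oscAt_localise_le hA hI hR hzh

end Summit.AtomisticToContinuum.Crystallization.Theorems.ExcessDecayLiouville

end
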